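import Summits.QuantumFields.YangMills.Theorems.BalabanUVNodesN15KingModelLandauTorus
import Summits.QuantumFields.YangMills.Theorems.BalabanUVNodesN15KingModelCurvatureDecay
import HarnessLib

/-!
# BalabanUVNodes ∕ N15 — THE KING-MODEL RUNG (PART Ϡ-c): THE LATTICE LANDAU LEVEL FOR KING's COVARIANT FINE OPERATOR — at the constant-flux field `U = fluxLink p ν₁` (Landau gauge,
# flux angle `θ = p′_{ν₀}` per `(ν₀,ν₁)`-plaquette) `Re⟨v,(−cΔ_U+m²)v⟩ ≥ (m² + c·Λ(θ))‖v‖²`, `Λ(θ) = |sin θ|∕2 − (1−cos θ)²∕4 ≥ |θ|∕4` (`|θ| ≤ 1`): a curvature mass LINEAR in the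
# flux, against PART Ϳ-c's quadratic `2c(2−2cos(θ∕4)) ≈ cθ²∕8`; generic coercivity ⟹ eigenvalue ∕ covariance-norm ∕ positivity ∕ decay engines
# (Track A, DAG node N15 = NE2; FAN-OUT v1.1 §N15 s3 «KING-MODEL RUNG … + what the curved case adds»; count-neutral)

HONEST FRAMING.  Count-neutral (cell `pub-ymgap`, seat `pub-ymgap-dag-n15-e` g47; `--supports stmt-QuantumFields-27247 --as helper` = K3ᴬ, KEY MAP v3).  King's fine covariance layer
`−cΔ_U + m²` ([King1986] (4.4) p.670 minimally coupled as in [Balaban1985BackgroundPropagators] (3.3) p.391, (3.23) p.394; PART Ͱ-a `covLapF`) at the `U(1)` constant-flux field of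
PART Ͻ-q on ONE finite torus at fixed spacing; elementary spectral consequences.  NOT Bałaban's `G_k(U)` (no block term); NOT [Balaban1985BackgroundPropagators] (3.42); NOT a node
discharge (N15 of record untouched); nothing continuum ∕ ℝ⁴ ∕ OS ∕ Clay.

THE RESULTS (`K` any period vector, `c ≥ 0`; `Λ = landauGap` of PART Ϡ-a; `p′ = sOf K p ∈ (−π,π]`):
* §1 GENERIC COERCIVITY ENGINES (any unitary `U`, any fibre): from a form bound `κ·Σ_x‖v_x‖² ≤ Re⟨v,(−cΔ_U+m²)v⟩` — ★ `eigenvalues_covLapF_ge_of_coercive` (every eigenvalue `≥ κ`),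
  ★ `posDef_covLapF_of_coercive` (`κ > 0`), ★ `norm_toLp_inv_mulVec_le_of_coercive`, ★★ `l2_opNorm_covLapF_inv_le_of_coercive` (`‖(−cΔ_U+m²)⁻¹‖ ≤ κ⁻¹`) — the `κ`-abstract form of
  PART Ϳ-b's plaquette engines, so that ANY source of coercivity (plaquettes, Landau, holonomy) feeds the same spectral conclusions and Ϳ-g's Combes–Thomas decay.
* §2 THE `U(1)` DICTIONARY: `norm_fib_unit` (`‖v_x‖ = |v(x)|` on the one-component fibre), `fluxLink_apply_same`∕`_of_ne`, ★ `covDiff_fluxLink_of_ne` ∕ ★ `covDiff_fluxLink_same` (the two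
  covariant bond differences of the flux field ARE `|v(x) − v(x+e_{ν₀})|` and `|v(x) − χ_p(x)v(x+e_{ν₁})|`), `sum_two_dirs_le_sum` (two bond directions out of `d+1`).
* §3 ★★★ **`re_quadForm_covLapF_fluxLink_ge_landau`**: for `ν₀ ≠ ν₁`, `p_{ν₁} = 0`: `(m² + c·Λ(p′_{ν₀}))·Σ_x‖v_x‖² ≤ Re⟨v,(−cΔ_U+m²)v⟩` (PART Ϡ-b `landau_torus_bound` inside PART Ͱ-d's
  covariant Dirichlet form); ★★★ **`re_quadForm_covLapF_fluxLink_ge_best`** (the better of the two roads: `κ = m² + c·max(2(2−2cos(p′∕4)), Λ(p′))`); ★★ `eigenvalues_covLapF_fluxLink_ge_landau`,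
  ★★ **`l2_opNorm_covLapF_fluxLink_inv_le_landau`**, ★★ **`posDef_covLapF_fluxLink_massless_landau`** (`0 < |p′| ≤ 1`, `c > 0`), ★★ `l2_opNorm_covLapF_fluxLink_massless_inv_le_landau`
  (`‖(−cΔ_U)⁻¹‖ ≤ 4∕(c|p′|)` for `0 < |p′| ≤ 1` — PART Ϳ-c gave `(2c(2−2cos(p′∕4)))⁻¹ ≈ 8∕(cp′²)`), ★★ `norm_covLapF_fluxLink_massless_inv_entry_le_landau` (Combes–Thomas decay of the
  massless flux covariance at the LINEAR rate budget, Ϳ-g's engine).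
WHAT THE CURVED CASE ADDS (as theorems): at small constant curvature `θ` the covariant Laplacian's gap is of order `θ` — the lattice shadow of the lowest Landau level `(p−A)² ≥ B` — not
`θ²`; PART Ϡ-d reads this in King's `η`-units (the mass survives the continuum limit).  HONEST: Landau gauge (`p_{ν₁} = 0`; general constant-flux fields are gauge ∕ translation images,
PART Ϳ-h), `U(1)` fibre; the constant `½` in `Λ` is half the true Landau level (Ϡ-a header).
PRIOR TREE ART (by name): Ϡ-a (`landauGap`, `landauGap_ge_quarter`, `landauGap_pos`, `plaquetteGap_le_landauGap`), Ϡ-b (`landau_torus_bound`), Ͱ-a (`covLapF`, `isHermitian_covLapF`), Ͱ-b (`fib`,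
`fib_apply`), Ͱ-d (`re_quadForm_covLapF`, `im_quadForm_covLapF`), Ͱ-f (`sum_norm_fib_sq`, `re_star_dotProduct_le_norm_mul_norm`), Ϳ-c (`toEuclideanLin_unit_eq_smul`, `re_quadForm_covLapF_fluxLink_ge`,
`fluxGap_pos`), Ϳ-g (`isUnit_covLapF_of_coercive`, `norm_covLapF_inv_entry_le_exp_of_coercive`), Ͻ-q (`fluxLink`, `fluxLink_mem_unitaryGroup`), `B5Prop11Plancherel` (`Tor`, `unitVec`, `chi`, `sOf`,
`abs_sOf_le`), Mathlib (`Matrix.IsHermitian.eigenvalues_eq`, `eigenvectorBasis`, `PosDef.of_dotProduct_mulVec_pos`, `Matrix.cstar_norm_def`, `Finset.sum_le_sum_of_subset_of_nonneg`, `Finset.sum_pair`).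
Dedup (rg at filing): basename 0 files; needles `of_coercive` (only Ϳ-g's two), `norm_fib_unit|covDiff_fluxLink|ge_landau|_le_landau|ge_best` 0 tree files.  Locators: [King1986] (4.4) p.670,
(2.12) p.653; [Balaban1985BackgroundPropagators] (3.3) p.391, (3.23) p.394, (3.39) p.397; [Balaban1984PropagatorsI] (1.29) p.23; [DodziukMathai2006] §1 Cor 1.3 (diamagnetic comparison,
notion); [tHooft1979Flux] NPB 153 (flux sectors, notion).  0 `sorry`, 0 `def`.
-/

noncomputable section
open scoped BigOperators ComplexConjugate ComplexOrder InnerProductSpace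
open Finset Matrix WithLp

namespace Summit.QuantumFields.YangMills.BalabanUVNodes.N15KingModelRung.Landau

open Literature.MathematicalPhysics.QuantumFieldTheory.Balaban1983to89.B5Prop11Plancherel (Tor unitVec chi sOf abs_sOf_le)
open Literature.MathematicalPhysics.QuantumFieldTheory.King1986.Torus (tdistT)
open Summit.QuantumFields.YangMills.BalabanUVNodes.N15KingModelRung.Covariant (covLapF fib fib_apply isHermitian_covLapF re_quadForm_covLapF im_quadForm_covLapF sum_norm_fib_sq
  re_star_dotProduct_le_norm_mul_norm)
open Summit.QuantumFields.YangMills.BalabanUVNodes.N15KingModelRung.Cover (fluxLink fluxLink_mem_unitaryGroup)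
open Summit.QuantumFields.YangMills.BalabanUVNodes.N15KingModelRung.Curvature (toEuclideanLin_unit_eq_smul re_quadForm_covLapF_fluxLink_ge fluxGap_pos isUnit_covLapF_of_coercive
  norm_covLapF_inv_entry_le_exp_of_coercive exists_rate_of_coercive)

variable {d : ℕ} (K : Fin (d + 1) → ℕ)

/-! ## §1 Generic coercivity engines -/

section Coercive

variable {𝕜 : Type*} [RCLike 𝕜] {n : Type*} [Fintype n] [DecidableEq n]
variable [hK : ∀ μ, NeZero (K μ)] {c m2 : ℝ}

/-- ★ **COERCIVITY ⟹ EVERY EIGENVALUE `≥ κ`** (any link field for which `−cΔ_U+m²` is Hermitian, i.e. all). [folklore] -/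
theorem eigenvalues_covLapF_ge_of_coercive (c m2 : ℝ) (U : Tor K × Fin (d + 1) → Matrix n n 𝕜) {κ : ℝ}
    (hcoer : ∀ v : Tor K × n → 𝕜, κ * ∑ x, ‖fib K v x‖ ^ 2 ≤ RCLike.re (star v ⬝ᵥ (covLapF K c m2 U *ᵥ v))) (i : Tor K × n) :
    κ ≤ (isHermitian_covLapF K c m2 U).eigenvalues i := by
  set hA := isHermitian_covLapF K c m2 U
  rw [hA.eigenvalues_eq i]
  have h := hcoer (⇑(hA.eigenvectorBasis i))
  have hnorm : ‖(toLp 2 (⇑(hA.eigenvectorBasis i)) : EuclideanSpace 𝕜 (Tor K × n))‖ = 1 := hA.eigenvectorBasis.orthonormal.1 i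
  rw [sum_norm_fib_sq, hnorm, one_pow, mul_one] at h
  exact h

/-- ★ **COERCIVITY WITH `κ > 0` ⟹ POSITIVE DEFINITE**. [folklore] -/
theorem posDef_covLapF_of_coercive (c m2 : ℝ) (U : Tor K × Fin (d + 1) → Matrix n n 𝕜) {κ : ℝ} (hκ : 0 < κ)
    (hcoer : ∀ v : Tor K × n → 𝕜, κ * ∑ x, ‖fib K v x‖ ^ 2 ≤ RCLike.re (star v ⬝ᵥ (covLapF K c m2 U *ᵥ v))) : (covLapF K c m2 U).PosDef := by
  refine PosDef.of_dotProduct_mulVec_pos (isHermitian_covLapF K c m2 U) fun v hv => ?_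
  have h := hcoer v
  rw [sum_norm_fib_sq] at h
  have hvn : 0 < ‖(toLp 2 v : EuclideanSpace 𝕜 (Tor K × n))‖ ^ 2 := by
    have : (toLp 2 v : EuclideanSpace 𝕜 (Tor K × n)) ≠ 0 := fun h0 => hv (by simpa using congrArg ofLp h0)
    positivity
  exact RCLike.pos_iff.mpr ⟨lt_of_lt_of_le (mul_pos hκ hvn) h, im_quadForm_covLapF K c m2 U v⟩

/-- ★ **COERCIVITY ⟹ `‖G_Uw‖ ≤ κ⁻¹‖w‖`** (`κ > 0`; `G_U = (−cΔ_U+m²)⁻¹`). [cite: Balaban1985BackgroundPropagators, (3.39) p.397] -/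
theorem norm_toLp_inv_mulVec_le_of_coercive (c m2 : ℝ) (U : Tor K × Fin (d + 1) → Matrix n n 𝕜) {κ : ℝ} (hκ : 0 < κ)
    (hcoer : ∀ v : Tor K × n → 𝕜, κ * ∑ x, ‖fib K v x‖ ^ 2 ≤ RCLike.re (star v ⬝ᵥ (covLapF K c m2 U *ᵥ v))) (w : Tor K × n → 𝕜) :
    ‖(toLp 2 ((covLapF K c m2 U)⁻¹ *ᵥ w) : EuclideanSpace 𝕜 (Tor K × n))‖ ≤ κ⁻¹ * ‖(toLp 2 w : EuclideanSpace 𝕜 (Tor K × n))‖ := by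
  set v := (covLapF K c m2 U)⁻¹ *ᵥ w with hv
  have hdet : IsUnit (covLapF K c m2 U).det := (Matrix.isUnit_iff_isUnit_det _).mp (isUnit_covLapF_of_coercive K c m2 U hκ hcoer)
  have hMv : covLapF K c m2 U *ᵥ v = w := by rw [hv, mulVec_mulVec, Matrix.mul_nonsing_inv _ hdet, one_mulVec]
  have h1 := hcoer v
  rw [sum_norm_fib_sq, hMv] at h1
  have h2 := re_star_dotProduct_le_norm_mul_norm K v w
  set a := ‖(toLp 2 v : EuclideanSpace 𝕜 (Tor K × n))‖ with ha
  set b := ‖(toLp 2 w : EuclideanSpace 𝕜 (Tor K × n))‖ with hb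
  have ha0 : 0 ≤ a := norm_nonneg _
  have hb0 : 0 ≤ b := norm_nonneg _
  rw [le_inv_mul_iff₀ hκ]
  by_cases hz : a = 0
  · rw [hz, mul_zero]; exact hb0
  · have hapos : 0 < a := lt_of_le_of_ne ha0 (Ne.symm hz)
    nlinarith [h1, h2]

open scoped Matrix.Norms.L2Operator in
/-- ★★ **COERCIVITY ⟹ `‖(−cΔ_U+m²)⁻¹‖_{ℓ²→ℓ²} ≤ κ⁻¹`** (`κ > 0`). [cite: Balaban1985BackgroundPropagators, (3.39) p.397] -/
theorem l2_opNorm_covLapF_inv_le_of_coercive (c m2 : ℝ) (U : Tor K × Fin (d + 1) → Matrix n n 𝕜) {κ : ℝ} (hκ : 0 < κ)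
    (hcoer : ∀ v : Tor K × n → 𝕜, κ * ∑ x, ‖fib K v x‖ ^ 2 ≤ RCLike.re (star v ⬝ᵥ (covLapF K c m2 U *ᵥ v))) :
    ‖(covLapF K c m2 U)⁻¹‖ ≤ κ⁻¹ := by
  rw [Matrix.cstar_norm_def]
  refine ContinuousLinearMap.opNorm_le_bound _ (inv_nonneg.2 hκ.le) fun w => ?_
  have hw : w = toLp 2 (ofLp w) := rfl
  rw [hw, Matrix.toEuclideanCLM_toLp]
  exact norm_toLp_inv_mulVec_le_of_coercive K c m2 U hκ hcoer (ofLp w)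

end Coercive

/-! ## §2 The `U(1)` dictionary for the flux field -/

section Dictionary

variable [hK : ∀ μ, NeZero (K μ)]

omit hK in
/-- On the one-component fibre the fibre norm is the modulus of the entry: `‖v_x‖ = |v(x)|`. [folklore] -/
theorem norm_fib_unit (v : Tor K × Unit → ℂ) (x : Tor K) : ‖fib K v x‖ = ‖v (x, ())‖ := by
  rw [EuclideanSpace.norm_eq, Fintype.sum_unique, fib_apply, Real.sqrt_sq (norm_nonneg _)]

omit hK in
/-- … and for any vector of the one-component fibre. [folklore] -/
theorem norm_euclidean_unit (u : EuclideanSpace ℂ Unit) : ‖u‖ = ‖u ()‖ := by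
  rw [EuclideanSpace.norm_eq, Fintype.sum_unique, Real.sqrt_sq (norm_nonneg _)]

/-- The flux field on its own direction: `U(x,ν₁) = χ_p(x)`. [cite: tHooft1979Flux, NPB 153 (flux sectors, notion)] -/
theorem fluxLink_apply_same (p x : Tor K) (ν₁ : Fin (d + 1)) : fluxLink K p ν₁ (x, ν₁) () () = chi K p x := by
  simp [fluxLink]

/-- The flux field on the other directions: `U(x,μ) = 1`, `μ ≠ ν₁`. [cite: tHooft1979Flux, NPB 153 (flux sectors, notion)] -/
theorem fluxLink_apply_of_ne (p x : Tor K) {μ ν₁ : Fin (d + 1)} (hμ : μ ≠ ν₁) : fluxLink K p ν₁ (x, μ) = 1 := by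
  simp [fluxLink, hμ]

/-- ★ THE COVARIANT BOND DIFFERENCE ALONG `μ ≠ ν₁` is the plain difference: `‖v_x − U(x,μ)v_{x+e_μ}‖ = |v(x) − v(x+e_μ)|`. [cite: Balaban1985BackgroundPropagators, (3.3) p.391] -/
theorem covDiff_fluxLink_of_ne (p : Tor K) {μ ν₁ : Fin (d + 1)} (hμ : μ ≠ ν₁) (v : Tor K × Unit → ℂ) (x : Tor K) :
    ‖fib K v x - Matrix.toEuclideanLin (fluxLink K p ν₁ (x, μ)) (fib K v (x + unitVec K μ))‖ = ‖v (x, ()) - v (x + unitVec K μ, ())‖ := by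
  rw [fluxLink_apply_of_ne K p x hμ, toEuclideanLin_unit_eq_smul, Matrix.one_apply_eq, one_smul, norm_euclidean_unit, PiLp.sub_apply, fib_apply, fib_apply]

/-- ★ THE COVARIANT BOND DIFFERENCE ALONG `ν₁` carries the Landau phase: `‖v_x − U(x,ν₁)v_{x+e_{ν₁}}‖ = |v(x) − χ_p(x)v(x+e_{ν₁})|`. [cite: Balaban1985BackgroundPropagators, (3.3) p.391] -/
theorem covDiff_fluxLink_same (p : Tor K) (ν₁ : Fin (d + 1)) (v : Tor K × Unit → ℂ) (x : Tor K) :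
    ‖fib K v x - Matrix.toEuclideanLin (fluxLink K p ν₁ (x, ν₁)) (fib K v (x + unitVec K ν₁))‖ = ‖v (x, ()) - chi K p x * v (x + unitVec K ν₁, ())‖ := by
  rw [toEuclideanLin_unit_eq_smul, fluxLink_apply_same, norm_euclidean_unit, PiLp.sub_apply, PiLp.smul_apply, fib_apply, fib_apply, smul_eq_mul]

omit hK in
/-- Two directions out of `d+1`: for non-negative bond terms, `F ν₀ + F ν₁ ≤ Σ_μ F μ` (`ν₀ ≠ ν₁`). [folklore] -/
theorem sum_two_dirs_le_sum {ν₀ ν₁ : Fin (d + 1)} (hν : ν₀ ≠ ν₁) {F : Fin (d + 1) → ℝ} (hF : ∀ μ, 0 ≤ F μ) : F ν₀ + F ν₁ ≤ ∑ μ, F μ := by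
  rw [← Finset.sum_pair hν]
  exact Finset.sum_le_sum_of_subset_of_nonneg (Finset.subset_univ _) fun μ _ _ => hF μ

end Dictionary

/-! ## §3 The Landau floor for King's covariant operator at the flux field -/

section Flux

variable [hK : ∀ μ, NeZero (K μ)] {c : ℝ}

/-- ★★★ **THE LATTICE LANDAU LEVEL FOR KING's COVARIANT FINE OPERATOR**: for `U = fluxLink K p ν₁` with `p_{ν₁} = 0` (Landau gauge), `ν₀ ≠ ν₁`, `c ≥ 0` and every `m²`:
`(m² + c·Λ(p′_{ν₀}))·Σ_x‖v_x‖² ≤ Re⟨v,(−cΔ_U+m²)v⟩`, `Λ(θ) = |sin θ|∕2 − (1−cos θ)²∕4` — a uniform flux `θ` per `(ν₀,ν₁)`-plaquette lifts the bottom of the covariant kinetic spectrum by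
`c·Λ(θ) ≥ c|θ|∕4` (`|θ| ≤ 1`): LINEAR in the curvature (PART Ϳ-c: `2c(2−2cos(θ∕4)) ≈ cθ²∕8`). [cite: King1986, (4.4) p.670, (2.12) p.653; Balaban1985BackgroundPropagators, (3.23) p.394] -/
theorem re_quadForm_covLapF_fluxLink_ge_landau (hc : 0 ≤ c) (m2 : ℝ) {p : Tor K} {ν₀ ν₁ : Fin (d + 1)} (hν : ν₀ ≠ ν₁) (hp : p ν₁ = 0) (v : Tor K × Unit → ℂ) :
    (m2 + c * landauGap (sOf K p ν₀)) * ∑ x, ‖fib K v x‖ ^ 2 ≤ (star v ⬝ᵥ (covLapF K c m2 (fluxLink K p ν₁) *ᵥ v)).re := by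
  have hre := re_quadForm_covLapF K c m2 (fluxLink_mem_unitaryGroup K p ν₁) v
  rw [show (star v ⬝ᵥ (covLapF K c m2 (fluxLink K p ν₁) *ᵥ v)).re = RCLike.re (star v ⬝ᵥ (covLapF K c m2 (fluxLink K p ν₁) *ᵥ v)) from rfl, hre]
  set w : Tor K → ℂ := fun x => v (x, ()) with hw
  have hfib : ∀ x, ‖fib K v x‖ ^ 2 = ‖w x‖ ^ 2 := fun x => by rw [norm_fib_unit]
  have hL := landau_torus_bound K ν₀ hp w
  -- the two relevant bond directions sit inside the full covariant kinetic term
  have hkin : ∑ x, (‖w x - w (x + unitVec K ν₀)‖ ^ 2 + ‖w x - chi K p x * w (x + unitVec K ν₁)‖ ^ 2)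
      ≤ ∑ x, ∑ μ, ‖fib K v x - Matrix.toEuclideanLin (fluxLink K p ν₁ (x, μ)) (fib K v (x + unitVec K μ))‖ ^ 2 := by
    refine Finset.sum_le_sum fun x _ => ?_
    have h := sum_two_dirs_le_sum hν (F := fun μ => ‖fib K v x - Matrix.toEuclideanLin (fluxLink K p ν₁ (x, μ)) (fib K v (x + unitVec K μ))‖ ^ 2) (fun μ => sq_nonneg _)
    rw [covDiff_fluxLink_of_ne K p hν, covDiff_fluxLink_same] at h
    exact h
  simp_rw [hfib]
  rw [add_mul]
  have hcL : c * landauGap (sOf K p ν₀) * ∑ x, ‖w x‖ ^ 2 ≤ c * ∑ x, ∑ μ, ‖fib K v x - Matrix.toEuclideanLin (fluxLink K p ν₁ (x, μ)) (fib K v (x + unitVec K μ))‖ ^ 2 := by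
    rw [mul_assoc]
    exact mul_le_mul_of_nonneg_left (hL.trans hkin) hc
  linarith

/-- ★★★ **THE BETTER OF THE TWO ROADS**: `(m² + c·max(2(2−2cos(p′_{ν₀}∕4)), Λ(p′_{ν₀})))·Σ_x‖v_x‖² ≤ Re⟨v,(−cΔ_U+m²)v⟩` — PART Ϳ-c's plaquette mass (better at flux angles near `π`) and the
Landau mass (better for `|p′| ≲ 1.9`) combined. [cite: King1986, (4.4) p.670; DodziukMathai2006, Cor 1.3 §1] -/
theorem re_quadForm_covLapF_fluxLink_ge_best (hc : 0 ≤ c) (m2 : ℝ) {p : Tor K} {ν₀ ν₁ : Fin (d + 1)} (hν : ν₀ ≠ ν₁) (hp : p ν₁ = 0) (v : Tor K × Unit → ℂ) :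
    (m2 + c * max (2 * (2 - 2 * Real.cos (sOf K p ν₀ / 4))) (landauGap (sOf K p ν₀))) * ∑ x, ‖fib K v x‖ ^ 2
      ≤ (star v ⬝ᵥ (covLapF K c m2 (fluxLink K p ν₁) *ᵥ v)).re := by
  rcases le_total (2 * (2 - 2 * Real.cos (sOf K p ν₀ / 4))) (landauGap (sOf K p ν₀)) with h | h
  · rw [max_eq_right h]; exact re_quadForm_covLapF_fluxLink_ge_landau K hc m2 hν hp v
  · rw [max_eq_left h]
    have h' := re_quadForm_covLapF_fluxLink_ge K hc m2 p hν v
    calc (m2 + c * (2 * (2 - 2 * Real.cos (sOf K p ν₀ / 4)))) * ∑ x, ‖fib K v x‖ ^ 2 = (m2 + 2 * c * (2 - 2 * Real.cos (sOf K p ν₀ / 4))) * ∑ x, ‖fib K v x‖ ^ 2 := by ring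
      _ ≤ _ := h'

/-- ★★ Every eigenvalue of `−cΔ_U+m²` at the flux field is `≥ m² + c·Λ(p′_{ν₀})`. [cite: King1986, (4.4) p.670] -/
theorem eigenvalues_covLapF_fluxLink_ge_landau (hc : 0 ≤ c) (m2 : ℝ) {p : Tor K} {ν₀ ν₁ : Fin (d + 1)} (hν : ν₀ ≠ ν₁) (hp : p ν₁ = 0) (i : Tor K × Unit) :
    m2 + c * landauGap (sOf K p ν₀) ≤ (isHermitian_covLapF K c m2 (fluxLink K p ν₁)).eigenvalues i :=
  eigenvalues_covLapF_ge_of_coercive K c m2 _ (fun v => re_quadForm_covLapF_fluxLink_ge_landau K hc m2 hν hp v) i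

/-- The Landau floor in its small-flux form: `m² + c|p′_{ν₀}|∕4 ≤ ` every eigenvalue (`|p′_{ν₀}| ≤ 1`). [cite: King1986, (4.4) p.670] -/
theorem eigenvalues_covLapF_fluxLink_ge_quarter (hc : 0 ≤ c) (m2 : ℝ) {p : Tor K} {ν₀ ν₁ : Fin (d + 1)} (hν : ν₀ ≠ ν₁) (hp : p ν₁ = 0) (hsmall : |sOf K p ν₀| ≤ 1) (i : Tor K × Unit) :
    m2 + c * (|sOf K p ν₀| / 4) ≤ (isHermitian_covLapF K c m2 (fluxLink K p ν₁)).eigenvalues i :=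
  le_trans (by nlinarith [landauGap_ge_quarter hsmall]) (eigenvalues_covLapF_fluxLink_ge_landau K hc m2 hν hp i)

open scoped Matrix.Norms.L2Operator in
/-- ★★ **`‖(−cΔ_U+m²)⁻¹‖_{ℓ²→ℓ²} ≤ (m² + c·Λ(p′_{ν₀}))⁻¹`** at the flux field whenever the right side is positive. [cite: Balaban1985BackgroundPropagators, (3.39) p.397] -/
theorem l2_opNorm_covLapF_fluxLink_inv_le_landau (hc : 0 ≤ c) {m2 : ℝ} {p : Tor K} {ν₀ ν₁ : Fin (d + 1)} (hν : ν₀ ≠ ν₁) (hp : p ν₁ = 0)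
    (hpos : 0 < m2 + c * landauGap (sOf K p ν₀)) : ‖(covLapF K c m2 (fluxLink K p ν₁))⁻¹‖ ≤ (m2 + c * landauGap (sOf K p ν₀))⁻¹ :=
  l2_opNorm_covLapF_inv_le_of_coercive K c m2 _ hpos fun v => re_quadForm_covLapF_fluxLink_ge_landau K hc m2 hν hp v

/-- The Landau curvature mass is positive at small non-zero flux: `p_{ν₀} ≠ 0`, `|p′_{ν₀}| ≤ 1 ⟹ Λ(p′_{ν₀}) > 0`. [folklore] -/
theorem landauGap_sOf_pos {p : Tor K} {ν₀ : Fin (d + 1)} (hp0 : p ν₀ ≠ 0) (hsmall : |sOf K p ν₀| ≤ 1) : 0 < landauGap (sOf K p ν₀) := by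
  refine landauGap_pos hsmall ?_
  unfold sOf
  have hK0 : (0 : ℝ) < K ν₀ := by exact_mod_cast Nat.pos_of_ne_zero (NeZero.ne _)
  have hv : ((p ν₀).valMinAbs : ℝ) ≠ 0 := by exact_mod_cast (ZMod.valMinAbs_eq_zero (p ν₀)).not.mpr hp0
  exact div_ne_zero (mul_ne_zero (by positivity) hv) hK0.ne'

/-- ★★ **THE MASSLESS COVARIANT LAPLACIAN AT SMALL NON-ZERO FLUX IS POSITIVE DEFINITE WITH A LINEAR GAP**: `c > 0`, `p_{ν₀} ≠ 0`, `p_{ν₁} = 0`, `|p′_{ν₀}| ≤ 1` ⟹ `−cΔ_U ≻ 0` with every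
eigenvalue `≥ c·Λ(p′) ≥ c|p′|∕4`. [cite: DodziukMathai2006, Cor 1.3 §1; King1986, (4.4) p.670] -/
theorem posDef_covLapF_fluxLink_massless_landau (hc : 0 < c) {p : Tor K} {ν₀ ν₁ : Fin (d + 1)} (hν : ν₀ ≠ ν₁) (hp : p ν₁ = 0) (hp0 : p ν₀ ≠ 0) (hsmall : |sOf K p ν₀| ≤ 1) :
    (covLapF K c 0 (fluxLink K p ν₁)).PosDef :=
  posDef_covLapF_of_coercive K c 0 _ (by rw [zero_add]; exact mul_pos hc (landauGap_sOf_pos K hp0 hsmall))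
    fun v => re_quadForm_covLapF_fluxLink_ge_landau K hc.le 0 hν hp v

open scoped Matrix.Norms.L2Operator in
/-- ★★ **`‖(−cΔ_U)⁻¹‖ ≤ 4∕(c·|p′_{ν₀}|)`** for the massless flux covariance at `0 < |p′_{ν₀}| ≤ 1` (`c > 0`, Landau gauge) — PART Ϳ-c's bound was `≈ 8∕(cp′²)`.
[cite: Balaban1985BackgroundPropagators, (3.39) p.397; DodziukMathai2006, Cor 1.3 §1] -/
theorem l2_opNorm_covLapF_fluxLink_massless_inv_le_landau (hc : 0 < c) {p : Tor K} {ν₀ ν₁ : Fin (d + 1)} (hν : ν₀ ≠ ν₁) (hp : p ν₁ = 0) (hp0 : p ν₀ ≠ 0) (hsmall : |sOf K p ν₀| ≤ 1) :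
    ‖(covLapF K c 0 (fluxLink K p ν₁))⁻¹‖ ≤ 4 / (c * |sOf K p ν₀|) := by
  have habs : 0 < |sOf K p ν₀| := abs_pos.mpr (by
    have h := landauGap_sOf_pos K hp0 hsmall
    intro h0; rw [h0, landauGap_zero] at h; exact lt_irrefl _ h)
  have hq : 0 < c * (|sOf K p ν₀| / 4) := by positivity
  have hκ : c * (|sOf K p ν₀| / 4) ≤ c * landauGap (sOf K p ν₀) := mul_le_mul_of_nonneg_left (landauGap_ge_quarter hsmall) hc.le
  have h := l2_opNorm_covLapF_inv_le_of_coercive K c 0 (fluxLink K p ν₁) hq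
    (fun v => le_trans (by rw [zero_add]; exact mul_le_mul_of_nonneg_right hκ (Finset.sum_nonneg fun x _ => sq_nonneg _))
      (re_quadForm_covLapF_fluxLink_ge_landau K hc.le 0 hν hp v))
  refine h.trans (le_of_eq ?_)
  rw [inv_eq_one_div, div_eq_div_iff (ne_of_gt hq) (mul_pos hc habs).ne']
  ring

/-- ★★ **COMBES–THOMAS AT THE LINEAR BUDGET**: for the massless flux covariance at `0 < |p′_{ν₀}| ≤ 1`, every `δ ≥ 0` with `2(d+1)c(cosh δ − 1) < c|p′|∕4` gives
`‖(−cΔ_U)⁻¹(x,y)‖ ≤ e^{−δd(x,y)}∕(c|p′|∕4 − 2(d+1)c(cosh δ−1))` (PART Ϳ-g's engine fed with the Landau floor: the admissible rate is `δ ≍ √|p′|`, against `≍ |p′|` from the plaquette floor).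
[cite: Balaban1985BackgroundPropagators, (3.39) p.397; King1986, (4.38) p.674] -/
theorem norm_covLapF_fluxLink_massless_inv_entry_le_landau (hc : 0 < c) {p : Tor K} {ν₀ ν₁ : Fin (d + 1)} (hν : ν₀ ≠ ν₁) (hp : p ν₁ = 0) (hp0 : p ν₀ ≠ 0) (hsmall : |sOf K p ν₀| ≤ 1)
    {δ : ℝ} (hδ : 0 ≤ δ) (hρ : 2 * ((d : ℝ) + 1) * c * (Real.cosh δ - 1) < c * (|sOf K p ν₀| / 4)) (x y : Tor K) :
    ‖(covLapF K c 0 (fluxLink K p ν₁))⁻¹ (x, ()) (y, ())‖ ≤ Real.exp (-(δ * tdistT K x y)) / (c * (|sOf K p ν₀| / 4) - 2 * ((d : ℝ) + 1) * c * (Real.cosh δ - 1)) := by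
  have habs : 0 < |sOf K p ν₀| := abs_pos.mpr (by
    have h := landauGap_sOf_pos K hp0 hsmall
    intro h0; rw [h0, landauGap_zero] at h; exact lt_irrefl _ h)
  have hq : 0 < c * (|sOf K p ν₀| / 4) := by positivity
  have hκ : c * (|sOf K p ν₀| / 4) ≤ c * landauGap (sOf K p ν₀) := mul_le_mul_of_nonneg_left (landauGap_ge_quarter hsmall) hc.le
  exact norm_covLapF_inv_entry_le_exp_of_coercive K hc.le 0 (fluxLink_mem_unitaryGroup K p ν₁) hq
    (fun v => le_trans (by rw [zero_add]; exact mul_le_mul_of_nonneg_right hκ (Finset.sum_nonneg fun x _ => sq_nonneg _))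
      (re_quadForm_covLapF_fluxLink_ge_landau K hc.le 0 hν hp v)) hδ hρ x y () ()

end Flux

end Summit.QuantumFields.YangMills.BalabanUVNodes.N15KingModelRung.Landau

end
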